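import Mathlib
import Summits.ValiantsHypothesis.ValiantsHypothesis.Theorems.BarrierLeverDefinableEquationsRazAnnihilatorsIff
import Summits.ValiantsHypothesis.ValiantsHypothesis.Theorems.BarrierLeverDefinableEquationsExplicitCoefficientsGeneric
import Summits.ValiantsHypothesis.ValiantsHypothesis.Theorems.BarrierLeverDefinableEquationsRazIntegrality

/-!
# Crux `BarrierLever.DefinableEquations` (stmt-8745) / `SingleSizeEquations` (stmt-8749) — THE
# COMBINATORIAL FORM: an explicit coefficient function in the kernel of Raz's nonnegative
# integer matrix (val-np-p5 g7; assembles the session's normal forms)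

Putting together
* the Raz-annihilator normal form `definableEquations_iff_razAnnihilators` (lead c6: the crux ⟺
  uniform Boolean-sum annihilators of the universal-circuit map `Γ` on the top monomials),
* the explicit-coefficient normal form for an arbitrary property of the equation
  (`ExplicitCoefficients.explicit_of_boolSum` / `boolSum_of_explicit`: Valiant's criterion at scale
  `N` and its converse), and
* the integrality of Raz's map (`RazIntegrality.eval_razPoint_forall_eq_zero_iff`: `E` annihilates
  the image of `Γ` iff `∑_m coeff_m E · N_b(m, κ) = 0` for every label exponent `κ`, with
  `N_b(m, κ) = coeff_κ ∏_e Γ_e^{m_e} ∈ ℕ` computed over `ℕ`),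

**`definableEquations_iff_combinatorial`**: `DefinableEquations` holds iff for some `c`, for every
`b`, eventually in `n`, there are `D, r ≤ N^c`, ONE polynomial `Q₀` on the bits
`(topMonomials n × Fin (D+1)) ⊕ Fin r` with `L(Q₀), deg Q₀ ≤ N^c`, and a nonzero finitely supported
`E` (exponents `≤ D`) whose coefficient function is the cube marginal of `Q₀` and which solves the
NONNEGATIVE INTEGER linear system `∑_{m} coeff_m E · N_b(m, κ) = 0` (all `κ`).

Everything in this statement except `E ≠ 0` and the size bounds is now discrete data: a Boolean
description `Q₀` of `φ = coeff E` and the `ℕ`-matrix `N_b` of Raz's universal circuit (whose entry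
`N_b(m, κ)` counts, with multiplicity, the multisets of monomial computation trees of the universal
graph with total leaf multiset `m` and total edge-label multiset `κ`).  This is the form in which a
sign-reversing-involution / cancellation construction would be checked.  The crux stays OPEN
(Chatterjee–Tengse 2023 §1.3 dir. 2); nothing here bears on `VP ≠ VNP`.  No definitions, no named
facts.  Refs: Raz 2010 §3.2; Bürgisser 2000 Prop. 2.20; CT23 §1.3.
-/

set_option linter.dupNamespace false

noncomputable section

namespace Summit.ValiantsHypothesis.ValiantsHypothesis.Theorems.BarrierLeverDefinableEquations

open MvPolynomial Literature.Computability.AlgebraicComplexity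
open Literature.Barriers.ValiantsHypothesis RazUniversal
open scoped BigOperators

namespace CombinatorialForm

/-- Budget at `n ≥ 2`: `3 ≤ N` and `#topMonomials n ≤ N`. [folklore] -/
theorem budget {n : ℕ} (hn : 2 ≤ n) [Fintype ↥(topMonomials n)] :
    3 ≤ Nat.choose (2 * n) n ∧ Fintype.card ↥(topMonomials n) ≤ Nat.choose (2 * n) n := by
  have hnN : 2 * n ≤ Nat.choose (2 * n) n := by
    have h1 := Nat.choose_le_middle 1 (2 * n)
    rwa [Nat.choose_one_right, Nat.mul_div_cancel_left n Nat.two_pos] at h1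
  exact ⟨by omega, SelGadget.card_topMonomials_le n⟩

/-- **Pointwise combinatorial form, level ⇒ scale**: a level-`a` Raz annihilator at `(n, b)`
(`n ≥ 2`) yields an `N^(2a+7)`-explicit coefficient function solving the `ℕ`-system.
[cite: Raz2010, §3.2 (p. 157)] -/
theorem combinatorial_of_razAnn {a b n : ℕ} (hn : 2 ≤ n)
    (h : ∃ q : ℕ, q ≤ (Nat.choose (2 * n) n) ^ a ∧
      ∃ H : MvPolynomial (↥(topMonomials n) ⊕ Fin q) ℂ,
        complexity H ≤ (Nat.choose (2 * n) n) ^ a ∧ H.totalDegree ≤ (Nat.choose (2 * n) n) ^ a ∧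
        boolSum H ≠ 0 ∧
        ∀ y : Lab (Fin n) n (razSlots n b) → ℂ, eval (razPoint n b y) (boolSum H) = 0) :
    ∃ D r : ℕ, D ≤ (Nat.choose (2 * n) n) ^ (2 * a + 7) ∧ r ≤ (Nat.choose (2 * n) n) ^ (2 * a + 7) ∧
      ∃ Q₀ : MvPolynomial ((↥(topMonomials n) × Fin (D + 1)) ⊕ Fin r) ℂ,
        complexity Q₀ ≤ (Nat.choose (2 * n) n) ^ (2 * a + 7) ∧
        Q₀.totalDegree ≤ (Nat.choose (2 * n) n) ^ (2 * a + 7) ∧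
        ∃ E : MvPolynomial ↥(topMonomials n) ℂ, E ≠ 0 ∧
          (∀ κ : Lab (Fin n) n (razSlots n b) →₀ ℕ,
            ∑ m ∈ E.support, coeff m E *
              ((coeff κ (m.prod fun e k =>
                uCoeff ℕ (Fin n) n (razSlots n b) (e : Fin n →₀ ℕ) ^ k) : ℕ) : ℂ) = 0) ∧
          (∀ m ∈ E.support, ∀ e, m e ≤ D) ∧
          ∀ m : ↥(topMonomials n) →₀ ℕ, (∀ e, m e ≤ D) → coeff m E =
            ∑ w : Fin r → Bool, eval (fun x => if Sum.elim
              (fun p : ↥(topMonomials n) × Fin (D + 1) => decide (m p.1 = (p.2 : ℕ))) w x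
              then (1 : ℂ) else 0) Q₀ := by
  classical
  haveI : Fintype ↥(topMonomials n) := (Finsupp.finite_of_degree_eq (σ := Fin n) n).fintype
  obtain ⟨hN, hI⟩ := budget hn
  have h' := ExplicitCoefficients.explicit_of_boolSum hN hI
    (fun E : MvPolynomial ↥(topMonomials n) ℂ => ∀ κ : Lab (Fin n) n (razSlots n b) →₀ ℕ,
      ∑ m ∈ E.support, coeff m E * ((coeff κ (m.prod fun e k =>
        uCoeff ℕ (Fin n) n (razSlots n b) (e : Fin n →₀ ℕ) ^ k) : ℕ) : ℂ) = 0)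
    (by
      obtain ⟨q, hq, H, hc, hd, hne, hvan⟩ := h
      exact ⟨q, hq, H, hc, hd, hne,
        (RazIntegrality.eval_razPoint_forall_eq_zero_iff (boolSum H)).mp hvan⟩)
  exact h'

/-- **Pointwise combinatorial form, scale ⇒ level**: an `N^c`-explicit nonzero solution of the
`ℕ`-system at `(n, b)` (`n ≥ 2`) is a level-`(2c+7)` Raz annihilator.
[cite: Raz2010, §3.2 (p. 157)] -/
theorem razAnn_of_combinatorial {c b n : ℕ} (hn : 2 ≤ n)
    (h : ∃ D r : ℕ, D ≤ (Nat.choose (2 * n) n) ^ c ∧ r ≤ (Nat.choose (2 * n) n) ^ c ∧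
      ∃ Q₀ : MvPolynomial ((↥(topMonomials n) × Fin (D + 1)) ⊕ Fin r) ℂ,
        complexity Q₀ ≤ (Nat.choose (2 * n) n) ^ c ∧
        Q₀.totalDegree ≤ (Nat.choose (2 * n) n) ^ c ∧
        ∃ E : MvPolynomial ↥(topMonomials n) ℂ, E ≠ 0 ∧
          (∀ κ : Lab (Fin n) n (razSlots n b) →₀ ℕ,
            ∑ m ∈ E.support, coeff m E *
              ((coeff κ (m.prod fun e k =>
                uCoeff ℕ (Fin n) n (razSlots n b) (e : Fin n →₀ ℕ) ^ k) : ℕ) : ℂ) = 0) ∧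
          (∀ m ∈ E.support, ∀ e, m e ≤ D) ∧
          ∀ m : ↥(topMonomials n) →₀ ℕ, (∀ e, m e ≤ D) → coeff m E =
            ∑ w : Fin r → Bool, eval (fun x => if Sum.elim
              (fun p : ↥(topMonomials n) × Fin (D + 1) => decide (m p.1 = (p.2 : ℕ))) w x
              then (1 : ℂ) else 0) Q₀) :
    ∃ q : ℕ, q ≤ (Nat.choose (2 * n) n) ^ (2 * c + 7) ∧
      ∃ H : MvPolynomial (↥(topMonomials n) ⊕ Fin q) ℂ,
        complexity H ≤ (Nat.choose (2 * n) n) ^ (2 * c + 7) ∧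
        H.totalDegree ≤ (Nat.choose (2 * n) n) ^ (2 * c + 7) ∧ boolSum H ≠ 0 ∧
        ∀ y : Lab (Fin n) n (razSlots n b) → ℂ, eval (razPoint n b y) (boolSum H) = 0 := by
  classical
  haveI : Fintype ↥(topMonomials n) := (Finsupp.finite_of_degree_eq (σ := Fin n) n).fintype
  obtain ⟨hN, hI⟩ := budget hn
  obtain ⟨q, hq, H, hc, hd, hne, hV⟩ := ExplicitCoefficients.boolSum_of_explicit hN hI
    (fun E : MvPolynomial ↥(topMonomials n) ℂ => ∀ κ : Lab (Fin n) n (razSlots n b) →₀ ℕ,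
      ∑ m ∈ E.support, coeff m E * ((coeff κ (m.prod fun e k =>
        uCoeff ℕ (Fin n) n (razSlots n b) (e : Fin n →₀ ℕ) ^ k) : ℕ) : ℂ) = 0) h
  exact ⟨q, hq, H, hc, hd, hne,
    (RazIntegrality.eval_razPoint_forall_eq_zero_iff (boolSum H)).mpr hV⟩

end CombinatorialForm

open CombinatorialForm

/-- **THE COMBINATORIAL FORM OF THE CRUX.**  `DefinableEquations` holds iff for some `c`, for every
size exponent `b`, eventually in `n`: there are `D, r ≤ N^c`, a bits-only polynomial `Q₀` with
`L(Q₀), deg Q₀ ≤ N^c`, and a NONZERO `E` on the top monomials with exponents `≤ D`, coefficient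
function `coeff_m E = ∑_w Q₀(oneHot m, w)`, solving Raz's nonnegative integer linear system
`∑_m coeff_m E · N_b(m, κ) = 0` for every label exponent `κ`
(`N_b(m, κ) = coeff_κ ∏_e Γ_e^{m_e}` over `ℕ`). [cite: Raz2010, §3.2 (p. 157)] -/
theorem definableEquations_iff_combinatorial :
    Summit.ValiantsHypothesis.ValiantsHypothesis.Theses.BarrierLever.DefinableEquations ↔
    ∃ c : ℕ, ∀ b : ℕ, ∃ n₀ : ℕ, ∀ n ≥ n₀,
      ∃ D r : ℕ, D ≤ (Nat.choose (2 * n) n) ^ c ∧ r ≤ (Nat.choose (2 * n) n) ^ c ∧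
      ∃ Q₀ : MvPolynomial ((↥(topMonomials n) × Fin (D + 1)) ⊕ Fin r) ℂ,
        complexity Q₀ ≤ (Nat.choose (2 * n) n) ^ c ∧
        Q₀.totalDegree ≤ (Nat.choose (2 * n) n) ^ c ∧
        ∃ E : MvPolynomial ↥(topMonomials n) ℂ, E ≠ 0 ∧
          (∀ κ : Lab (Fin n) n (razSlots n b) →₀ ℕ,
            ∑ m ∈ E.support, coeff m E *
              ((coeff κ (m.prod fun e k =>
                uCoeff ℕ (Fin n) n (razSlots n b) (e : Fin n →₀ ℕ) ^ k) : ℕ) : ℂ) = 0) ∧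
          (∀ m ∈ E.support, ∀ e, m e ≤ D) ∧
          ∀ m : ↥(topMonomials n) →₀ ℕ, (∀ e, m e ≤ D) → coeff m E =
            ∑ w : Fin r → Bool, eval (fun x => if Sum.elim
              (fun p : ↥(topMonomials n) × Fin (D + 1) => decide (m p.1 = (p.2 : ℕ))) w x
              then (1 : ℂ) else 0) Q₀ := by
  rw [definableEquations_iff_razAnnihilators]
  constructor
  · rintro ⟨a, ha⟩
    refine ⟨2 * a + 7, fun b => ?_⟩
    obtain ⟨n₀, hn₀⟩ := ha b
    refine ⟨max n₀ 2, fun n hn => ?_⟩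
    exact combinatorial_of_razAnn (le_trans (le_max_right _ _) hn)
      (hn₀ n (le_trans (le_max_left _ _) hn))
  · rintro ⟨c, hc⟩
    refine ⟨2 * c + 7, fun b => ?_⟩
    obtain ⟨n₀, hn₀⟩ := hc b
    refine ⟨max n₀ 2, fun n hn => ?_⟩
    exact razAnn_of_combinatorial (le_trans (le_max_right _ _) hn)
      (hn₀ n (le_trans (le_max_left _ _) hn))

end Summit.ValiantsHypothesis.ValiantsHypothesis.Theorems.BarrierLeverDefinableEquations

end
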